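import Literature.AlgebraicGeometry.Frobenioids.ArchimedeanFSMIPotential
import Literature.AlgebraicGeometry.Frobenioids.ArchimedeanSlitTools
import Literature.AlgebraicGeometry.Frobenioids.ArchimedeanHalfCircleArcs
import Literature.AlgebraicGeometry.Frobenioids.CircleOpensProofs2
import HarnessLib

/-!
# Frobenioids II, Proposition 3.4 (viii): test objects and test arrows of `C₀` for FSMI-morphisms

Mochizuki, *The geometry of Frobenioids II: poly-Frobenioids*, Kyushu J. Math. **62** (2008)
401–460, §3, proof of Proposition 3.4 (viii), p. 32 ll. 5–30 [cite: MochizukiFrdII2008, Prop 3.4 (viii) p.32]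
and Remark 3.3.1 p. 29, Lemma 3.2 (ix) p. 26, Example 3.3 (v) p. 29.

This file (abc-iut cell, layer L1, sub-DAG `SUBDAG-FrdII-Prop34.md` rows P34-L10/L11, seat
abc-iut-w5-d092) provides, at the level of the ambient category `C₀` (Ex. 3.3 (i)), the explicit test
objects and test arrows by which the angular Frobenioid `A₀` and the angloids `N₀`, `R₀` detect that a
given arrow is NOT a monomorphism / NOT irreducible / NOT fiberwise-surjective — the case analysis of the
printed proof that "`F₀` is of FSMFF-type" (p. 32):

* (the companion `ArchimedeanFSMITestsReal.lean` treats real objects and complex → real arrows);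
* complex → complex, linear: the sub-object `subObj Q D` on a connected open `D ⊆ B_Q` with its inclusion
  `subHom`, and the key **Lemma 3.2 (ix) step** `isIsotropic_of_linear_lifts`: if every such inclusion
  admits a common refinement with the linear isometry `φ : P → Q` (as fiberwise-surjectivity demands) and
  `φ` is not an isomorphism, then `Q` is isotropic — "either an isomorphism or a slit morphism".

Everything is explicit data of `C₀`; the three categories consume these in `ArchimedeanFSMIChains*.lean`. [FrdII] §3 is classical and undisputed; no numbered statement of the
paper is restated here.
-/

namespace Literature.AlgebraicGeometry.Frobenioids

open Set Function Topology Real CategoryTheory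
open scoped Pointwise

noncomputable section

namespace ArchFrd

namespace C0

variable {P Q X Y : C0}

/-! ### Twists as maps of `O_ℂ^×` -/

/-- The twist of an arrow of `D₀` on `O_ℂ^×` is the identity or inversion according to `twists`.
[cite: MochizukiFrdII2008, Def 3.1 (iv) p.24] -/
theorem unitPart_act_coe {L K : D0} (f : L ⟶ K) (z : ↥(normOneSubgroup ℂ)) :
    unitPart ℂ (f.act (z : ℂˣ)) = bif D0.Hom.twists f then z⁻¹ else z :=
  unitPart_galAct_coe _ z

/-- The twist by a Boolean is an involution of `O_ℂ^×`. [cite: MochizukiFrdII2008, Def 3.1 (iv) p.24] -/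
theorem twistBool_twistBool (σ : Bool) (z : ↥(normOneSubgroup ℂ)) :
    (bif σ then (bif σ then z⁻¹ else z)⁻¹ else (bif σ then z⁻¹ else z)) = z := by
  cases σ <;> simp

/-- Twists compose by `xor`. [cite: MochizukiFrdII2008, Def 3.1 (iv) p.24] -/
theorem twistBool_xor (σ τ : Bool) (z : ↥(normOneSubgroup ℂ)) :
    (bif xor σ τ then z⁻¹ else z) = (bif τ then (bif σ then z⁻¹ else z)⁻¹ else (bif σ then z⁻¹ else z)) := by
  cases σ <;> cases τ <;> simp

/-- The twist of the conjugation automorphism transported to a base equal to `Spec ℂ`.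
[cite: MochizukiFrdII2008, Def 3.1 (i) p.23] -/
theorem twists_eqToHom_conj {K : D0} (hK : K = D0.complex) :
    D0.Hom.twists (eqToHom hK ≫ D0.conj ≫ eqToHom hK.symm) = true := by
  subst hK; simp

/-- Twists along a composite whose final base is equal to `Spec ℂ` add up.
[cite: MochizukiFrdII2008, Def 3.1 (i) p.23] -/
theorem twists_comp_of_eq_complex {M L K : D0} (hK : K = D0.complex) (f : M ⟶ L) (g : L ⟶ K) :
    D0.Hom.twists (f ≫ g) = xor (D0.Hom.twists f) (D0.Hom.twists g) := by
  subst hK; exact D0.twists_comp_complex f g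

/-! ### Sub-objects on a connected open part of the angular part -/

/-- The angular region with angular part a given [nonempty] connected open `D ⊆ O_ℂ^×` and a given tip.
[cite: MochizukiFrdII2008, Def 3.1 (iii) p.24] -/
def regionOfDir (D : Set ↥(normOneSubgroup ℂ)) (hD : IsConnected D) (hDo : IsOpen D) (t : PosReal) :
    AngularRegion ℂ where
  dir := D
  tip := t
  isOpen_dir := hDo
  isConnected_inter z := by
    haveI : ConnectedSpace ↥(normOneSubgroup ℂ) := connectedSpace_iff_univ.mpr isConnected_univ_normOne
    rw [PreconnectedSpace.connectedComponent_eq_univ, inter_univ]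
    exact hD

/-- The object of `C₀` over the base of a complex object `Q` whose angular region has angular part `D`
and the tip of `Q` (a test object for fiberwise-surjectivity, proof of Lemma 3.2 (ix) / Ex. 3.3 (v)).
[cite: MochizukiFrdII2008, Prop 3.4 (viii) p.32] -/
def subObj (Q : C0) (hQ : Q.IsComplexObj) (D : Set ↥(normOneSubgroup ℂ)) (hD : IsConnected D)
    (hDo : IsOpen D) : C0 where
  base := Q.base
  region := regionOfDir D hD hDo Q.region.tip
  isIsotropic_of_isReal h := absurd (h.symm.trans hQ) (by decide)

/-- The inclusion `(id, 1, 1) : subObj Q D → Q` for `D ⊆ B_Q`. [cite: MochizukiFrdII2008, Prop 3.4 (viii) p.32] -/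
def subHom (Q : C0) (hQ : Q.IsComplexObj) {D : Set ↥(normOneSubgroup ℂ)} (hD : IsConnected D)
    (hDo : IsOpen D) (hDQ : D ⊆ Q.region.dir) : subObj Q hQ D hD hDo ⟶ Q where
  base := 𝟙 Q.base
  degFr := 1
  scalar := 1
  scalar_mem := one_mem _
  mapsTo := by
    rw [one_smul, PNat.one_coe, pow_one]
    change (regionOfDir D hD hDo Q.region.tip).carrier ⊆ pullRegion Q (𝟙 Q.base)
    rw [pullRegion_id]
    intro u hu
    exact ⟨hDQ hu.1, hu.2⟩

/-- The inclusion of a sub-object is a linear isometry with trivial base.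
[cite: MochizukiFrdII2008, Prop 3.4 (viii) p.32] -/
theorem subHom_data (Q : C0) (hQ : Q.IsComplexObj) {D : Set ↥(normOneSubgroup ℂ)} (hD : IsConnected D)
    (hDo : IsOpen D) (hDQ : D ⊆ Q.region.dir) :
    Base (subHom Q hQ hD hDo hDQ) = 𝟙 Q.base ∧ degFr (subHom Q hQ hD hDo hDQ) = 1 ∧
      scalar (subHom Q hQ hD hDo hDQ) = 1 ∧
      PreFrobenioid.IsIsometry toElem (subHom Q hQ hD hDo hDQ) := by
  refine ⟨rfl, rfl, rfl, ?_⟩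
  rw [A0.isIsometry_iff_norm_mul_tip_pow]
  change ‖((1 : ℂˣ) : ℂ)‖ * (Q.region.tip : ℝ) ^ ((1 : ℕ+) : ℕ) = Q.region.tip
  rw [Units.val_one, norm_one, one_mul, PNat.one_coe, pow_one]

/-- The shadow of the inclusion of a sub-object is `D`. [cite: MochizukiFrdII2008, Prop 3.4 (viii) p.32] -/
theorem shadow_subHom (Q : C0) (hQ : Q.IsComplexObj) {D : Set ↥(normOneSubgroup ℂ)}
    (hD : IsConnected D) (hDo : IsOpen D) (hDQ : D ⊆ Q.region.dir) :
    unitPart ℂ '' Hom.image (subHom Q hQ hD hDo hDQ) = D := by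
  rw [image_unitPart_homImage]
  change unitPart ℂ (1 : ℂˣ) • D ^ ((1 : ℕ+) : ℕ) = D
  rw [unitPart_one, one_smul, PNat.one_coe, pow_one]

/-! ### Lemma 3.2 (ix): a non-invertible linear isometry between complex objects all of whose
"sub-object tests" lift has isotropic codomain -/

/-- The image directions `τ_φ((c/|c|) · B_P) ⊆ B_Q` of a linear arrow, read in the frame of `Q`.
[cite: MochizukiFrdII2008, Prop 3.4 (viii) p.32] -/
theorem twist_shadow_subset_dir (φ : P ⟶ Q) (hlin : degFr φ = 1) :
    (fun z : ↥(normOneSubgroup ℂ) => unitPart ℂ ((Base φ).act (z : ℂˣ))) ''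
        (unitPart ℂ (scalar φ) • P.region.dir) ⊆ Q.region.dir := by
  obtain ⟨A, -, -, hAd, hsub, -⟩ := smul_dir_pow_subset φ
  rw [hlin, PNat.one_coe, pow_one] at hsub
  rintro _ ⟨w, hw, rfl⟩
  obtain ⟨y, hy, hyw⟩ := (hAd ▸ hsub hw : w ∈ _)
  rw [← hyw]
  change unitPart ℂ ((Base φ).act ((unitPart ℂ ((Base φ).act (y : ℂˣ)) : ℂˣ))) ∈ Q.region.dir
  rw [twist_twist]
  exact hy

/-- **Lemma 3.2 (ix) step of the proof of Prop. 3.4 (viii)** ("if the isometric base-isomorphism `φ`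
is linear, then it is an isometric pre-step, hence [cf. the fiberwise-surjectivity of `φ`; Lemma 3.2,
(ix); Example 3.3, (v)] either an isomorphism or a slit morphism", p. 32 ll. 15–18): let `φ : P → Q`
be a linear isometry between complex objects which is not an isomorphism; if for every connected open
`D ⊆ B_Q` the inclusion `subObj Q D → Q` and `φ` admit a common refinement `W → P`, `W → subObj Q D`
(as the fiberwise-surjectivity of `φ` in `A₀`/`N₀`/`R₀` provides), then `Q` is isotropic.
[cite: MochizukiFrdII2008, Prop 3.4 (viii) p.32] -/
theorem isIsotropic_of_linear_lifts (φ : P ⟶ Q) (hP : P.IsComplexObj) (hQ : Q.IsComplexObj)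
    (hlin : degFr φ = 1) (hiso : PreFrobenioid.IsIsometry toElem φ) (hnot : ¬ IsIso φ)
    (hfs : ∀ (D : Set ↥(normOneSubgroup ℂ)) (hD : IsConnected D) (hDo : IsOpen D)
      (hDQ : D ⊆ Q.region.dir), ∃ (W : C0) (δP : W ⟶ P) (δZ : W ⟶ subObj Q hQ D hD hDo),
        δP ≫ φ = δZ ≫ subHom Q hQ hD hDo hDQ) :
    Q.region.IsIsotropic := by
  haveI : IsIso (Base φ) := D0.isIso_of_isComplex _ hP hQ
  -- the image directions `S ⊆ B_Q`
  set τ : ↥(normOneSubgroup ℂ) → ↥(normOneSubgroup ℂ) :=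
    fun z => unitPart ℂ ((Base φ).act (z : ℂˣ)) with hτ
  have hτinv : ∀ z, τ (τ z) = z := fun z => twist_twist (Base φ) z
  have hτinj : Injective τ := twist_injective (Base φ)
  set S := τ '' (unitPart ℂ (scalar φ) • P.region.dir) with hS
  have hSQ : S ⊆ Q.region.dir := twist_shadow_subset_dir φ hlin
  have hPc : IsConnected P.region.dir := P.region.isConnected_dir
  have hPo : IsOpen P.region.dir := P.region.isOpen_dir
  -- `S` is connected open (a translate, possibly inverted)
  have hSco : IsConnected S ∧ IsOpen S := by
    have h1 : IsConnected (unitPart ℂ (scalar φ) • P.region.dir) := isConnected_smul _ hPc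
    have h2 : IsOpen (unitPart ℂ (scalar φ) • P.region.dir) := isOpen_smul _ hPo
    have hτ' : τ = fun z => bif D0.Hom.twists (Base φ) then z⁻¹ else z := by
      funext z; exact unitPart_act_coe _ z
    rw [hS, hτ']
    cases D0.Hom.twists (Base φ)
    · simp only [Bool.cond_false, image_id']; exact ⟨h1, h2⟩
    · simp only [Bool.cond_true, image_inv_eq_inv]; exact ⟨isConnected_inv h1, isOpen_inv' h2⟩
  -- `S ≠ B_Q`, since `φ` is not an isomorphism
  have hττ : ∀ T : Set ↥(normOneSubgroup ℂ), τ '' (τ '' T) = T := fun T => by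
    ext w
    constructor
    · rintro ⟨_, ⟨v, hv, rfl⟩, rfl⟩; rw [hτinv]; exact hv
    · intro hw; exact ⟨τ w, ⟨w, hw, rfl⟩, hτinv w⟩
  have hSne : S ≠ Q.region.dir := by
    intro hSeq
    apply hnot
    have h1 : unitPart ℂ (scalar φ) • P.region.dir = τ '' Q.region.dir := by
      have := congrArg (Set.image τ) hSeq
      rw [hS, hττ] at this
      exact this
    rw [isIso_iff_shadow_eq φ ⟨hlin, (inferInstance : IsIso (Base φ))⟩ hiso,
      image_unitPart_homImage, image_unitPart_pullRegion, hlin, PNat.one_coe, pow_one]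
    exact h1
  -- Lemma 3.2 (ix) on `S¹`: a connected open `D ⊆ B_Q` disjoint from `S`
  by_contra hQi
  obtain ⟨D, hD, hDo, hDQ, hSD⟩ : ∃ D : Set ↥(normOneSubgroup ℂ), IsConnected D ∧ IsOpen D ∧
      D ⊆ Q.region.dir ∧ S ∩ D = ∅ := by
    have hset : CircleOpens.Setting (ucHomeo ⁻¹' S) (ucHomeo ⁻¹' Q.region.dir) :=
      ⟨ucHomeo.isConnected_preimage.2 hSco.1, ucHomeo.isOpen_preimage.2 hSco.2,
        ucHomeo.isConnected_preimage.2 Q.region.isConnected_dir,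
        ucHomeo.isOpen_preimage.2 Q.region.isOpen_dir, preimage_mono hSQ⟩
    have hne : ucHomeo ⁻¹' S ≠ ucHomeo ⁻¹' Q.region.dir := fun h =>
      hSne (ucHomeo.surjective.preimage_injective h)
    have hnu : ucHomeo ⁻¹' Q.region.dir ≠ univ := fun h => hQi (by
      have : Q.region.dir = univ := by
        rw [← ucHomeo.surjective.image_preimage Q.region.dir, h, image_univ, ucHomeo.range_coe]
      exact this)
    by_contra hno
    refine hnu (CircleOpens.ItemIX_holds _ _ hset hne ?_).1
    rintro ⟨D', hD'c, hD'o, hD'B, hD'S⟩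
    refine hno ⟨ucHomeo '' D', ucHomeo.isConnected_image.2 hD'c, ucHomeo.isOpen_image.2 hD'o,
      (by rintro _ ⟨x, hx, rfl⟩; exact hD'B hx), ?_⟩
    refine eq_empty_iff_forall_notMem.2 ?_
    rintro _ ⟨hwS, x, hx, rfl⟩
    have : x ∈ ucHomeo ⁻¹' S ∩ D' := ⟨hwS, hx⟩
    rw [hD'S] at this
    exact this
  -- the common refinement and its shadow
  obtain ⟨W, δP, δZ, hsq⟩ := hfs D hD hDo hDQ
  have hne : (unitPart ℂ '' Hom.image (δP ≫ φ)).Nonempty := by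
    rw [image_unitPart_homImage]
    obtain ⟨b, hb⟩ := (W.region.dir_nonempty).pow (n := (degFr (δP ≫ φ) : ℕ))
    exact ⟨_, smul_mem_smul_set hb⟩
  obtain ⟨x, hx⟩ := hne
  -- through `P`: `x ∈ τ_{δP}(c · B_P)`
  have hxP : x ∈ (fun z : ↥(normOneSubgroup ℂ) => unitPart ℂ ((Base δP).act (z : ℂˣ))) ''
      (unitPart ℂ (scalar φ) • P.region.dir) := by
    have := shadow_comp_subset δP φ hx
    rwa [image_unitPart_homImage, hlin, PNat.one_coe, pow_one] at this
  -- through `subObj Q D`: `x ∈ τ_{δZ}(D)`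
  have hxZ : x ∈ (fun z : ↥(normOneSubgroup ℂ) => unitPart ℂ ((Base δZ).act (z : ℂˣ))) '' D := by
    have := shadow_comp_subset δZ (subHom Q hQ hD hDo hDQ) (hsq ▸ hx)
    rwa [shadow_subHom] at this
  -- the twists: `Base δZ = Base δP ≫ Base φ`
  have hbase : Base δZ = Base δP ≫ Base φ := by
    have := congrArg Base hsq
    rw [base_comp', base_comp'] at this
    rw [this]
    exact (Category.comp_id _).symm
  obtain ⟨y, hy, hyx⟩ := hxP
  obtain ⟨z, hz, hzx⟩ := hxZ
  change unitPart ℂ ((Base δP).act (y : ℂˣ)) = x at hyx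
  change unitPart ℂ ((Base δZ).act (z : ℂˣ)) = x at hzx
  rw [unitPart_act_coe] at hyx hzx
  have hQb : Q.base = D0.complex := hQ
  -- compare the two descriptions of `x`
  have key : τ y = z := by
    have htw : D0.Hom.twists (Base δZ) = xor (D0.Hom.twists (Base δP)) (D0.Hom.twists (Base φ)) := by
      rw [hbase]; exact twists_comp_of_eq_complex hQb _ _
    rw [htw, twistBool_xor] at hzx
    rw [hτ]
    change unitPart ℂ ((Base φ).act (y : ℂˣ)) = z
    rw [unitPart_act_coe]
    have hy : y = (bif D0.Hom.twists (Base δP) then x⁻¹ else x) := by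
      rw [← hyx, twistBool_twistBool]
    have hz : z = (bif D0.Hom.twists (Base δP) then
        (bif D0.Hom.twists (Base φ) then x⁻¹ else x)⁻¹ else (bif D0.Hom.twists (Base φ) then x⁻¹ else x)) := by
      rw [← hzx]
      generalize D0.Hom.twists (Base δP) = a
      generalize D0.Hom.twists (Base φ) = b
      cases a <;> cases b <;> simp
    rw [hy, hz]
    generalize D0.Hom.twists (Base δP) = a
    generalize D0.Hom.twists (Base φ) = b
    cases a <;> cases b <;> simp
  have hzS : z ∈ S := ⟨y, hy, key⟩
  have : z ∈ S ∩ D := ⟨hzS, hz⟩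
  rw [hSD] at this
  exact this

end C0

end ArchFrd

end

end Literature.AlgebraicGeometry.Frobenioids
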